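import Literature.AnabelianGeometry.EtaleTheta.Discharge.Sec1Prop15iiQuotOfStdLog
import Literature.AnabelianGeometry.EtaleTheta.Discharge.Sec1DeltaThetaZHat
import Literature.AnabelianGeometry.EtaleTheta.ZHatLevelDetermination
import Literature.AnabelianGeometry.EtaleTheta.ThetaSettingTopology
import HarnessLib

/-!
# [EtTh] Prop. 1.5 (ii): the `Ẑ`-linearity hypothesis of «F̈¹/F̈² = Ẑ·log(Ü)» DISCHARGED — endomorphisms of `Δ_Θ ≅ Ẑ(1)`
# commute (proof-only)

Mochizuki, *The étale theta function and its Frobenioid-theoretic manifestations*, Publ. RIMS **45** (2009), §1 p. 12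
«Δ_Θ (≅ Ẑ(1))», Prop. 1.5 (ii) p. 23 [cite: MochizukiEtTh2009, Prop 1.5 (ii) p.23]; Ribes–Zalesskii, *Profinite Groups*,
Thm. 2.7.1 (`Ẑ = lim ℤ/nℤ`). abc-iut cell, layer L2, seat abc-iut-L2-t1 (§1 ROOT owner). PROOF-ONLY (0 `def`) sequel of
`Sec1Prop15iiQuotOfStdLog` (`prop15iiQuot_of_stdLog`: the root predicate `Prop15iiQuot` from clause (a) + topology + the
hypothesis `hZ` «continuous endomorphisms of Δ_Θ commute with the conjugation action»). HERE `hZ` is PROVED under the §1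
guard `IsEtThOrigin` + `hYcl` (equivalently the census predicate `HasThetaTopology`): abc-iut-L2-d1's
`IsEtThOrigin.nonempty_deltaTheta_mulEquiv_zHat` gives `Δ_Θ ≃* Ẑ` (abstract groups), and by abc-iut-L4/L2's
`ZHatLevel.monoidHom_ext_eta` / `level_map` (every abstract endomorphism of `Ẑ` is a scalar on each `ℤ/nℤ`) ANY two
abstract endomorphisms of `Ẑ`, hence of `Δ_Θ`, commute — no continuity needed.
* `ZHatLevel.monoidHom_comp_comm` — `End(Ẑ)` is commutative;
* `ThetaSetting.deltaTheta_monoidHom_comp_comm` — so is `End(Δ_Θ)` once `Δ_Θ ≃* Ẑ`;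
* `ThetaSetting.IsEtThOrigin.endo_conjNormal_comm` — `hZ` under `IsEtThOrigin` + `hYcl`;
* `ThetaSetting.prop15iiQuot_of_stdLog_of_origin` — **`Prop15iiQuot E hC` from clause (a) alone**, given
  `HasThetaTopology D`, `IsEtThOrigin D`, `Compat` and compactness of `(Δ^tp_Ÿ)^Θ`.
HONEST FRAMING: [EtTh] is refereed; nothing here bears on [IUTchIII] Cor. 3.12; typed ≠ proved; no side taken.
-/

noncomputable section

open CategoryTheory ProfiniteGrp ProfiniteGrp.ProfiniteCompletion Topology

namespace Literature.AnabelianGeometry.EtaleTheta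

namespace ZHatLevel

/-- **`End(Ẑ)` is commutative**: two abstract endomorphisms of `Ẑ` commute (each acts on every `ℤ/nℤ` by a scalar,
`level_map`; elements are determined by their levels). [cite: RibesZalesskii2010, Thm 2.7.1] -/
theorem monoidHom_comp_comm
    (φ ψ : completion (GrpCat.of (Multiplicative ℤ)) →* completion (GrpCat.of (Multiplicative ℤ))) :
    φ.comp ψ = ψ.comp φ := by
  apply monoidHom_ext_eta
  change φ (ψ (eta 1)) = ψ (φ (eta 1))
  refine ext_of_level fun n => ?_
  apply Multiplicative.toAdd.injective
  rw [level_map n φ (ψ (eta 1)), level_map n ψ (φ (eta 1))]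
  exact mul_comm _ _

end ZHatLevel

namespace ThetaSetting

open Literature.AnabelianGeometry.SemiGraphs

variable {p : ℕ} [Fact p.Prime] {D : ThetaSetting p}

/-- **`End(Δ_Θ)` is commutative** once `Δ_Θ ≃* Ẑ` (abstract groups): transport of
`ZHatLevel.monoidHom_comp_comm`. [cite: MochizukiEtTh2009, §1 p.12] -/
theorem deltaTheta_monoidHom_comp_comm (ψ : ↥D.DeltaTheta ≃* ZHat) (φ₁ φ₂ : ↥D.DeltaTheta →* ↥D.DeltaTheta) :
    φ₁.comp φ₂ = φ₂.comp φ₁ := by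
  have key := ZHatLevel.monoidHom_comp_comm
    (ψ.toMonoidHom.comp (φ₁.comp ψ.symm.toMonoidHom)) (ψ.toMonoidHom.comp (φ₂.comp ψ.symm.toMonoidHom))
  ext t
  have h := DFunLike.congr_fun key (ψ t)
  simp only [MonoidHom.comp_apply, MulEquiv.coe_toMonoidHom, MulEquiv.symm_apply_apply] at h
  exact congrArg Subtype.val (ψ.injective h)

/-- **The `Ẑ`-linearity hypothesis `hZ` of `prop15iiQuot_of_stdLog`, PROVED under the §1 guard**: if `Δ_Θ ≃* Ẑ`
(abc-iut-L2-d1's `IsEtThOrigin.nonempty_deltaTheta_mulEquiv_zHat`, from `IsEtThOrigin` + `hYcl`), every continuous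
endomorphism of `Δ_Θ` commutes with the conjugation action of every element of `(Π^tp_X)^Θ`.
[cite: MochizukiEtTh2009, §1 p.12] -/
theorem IsEtThOrigin.endo_conjNormal_comm (hO : D.IsEtThOrigin)
    (hYcl : (D.DtpY.map D.toHat.toMonoidHom).topologicalClosure ≤
      D.DtpY.map D.toHat.toMonoidHom ⊔ (⁅⁅D.DeltaHat, D.DeltaHat⁆, D.DeltaHat⁆).topologicalClosure)
    (e : ↥D.DeltaTheta →ₜ* ↥D.DeltaTheta) (g : D.GtpTheta) (a : ↥D.DeltaTheta) :
    e (MulAut.conjNormal g a) = MulAut.conjNormal g (e a) := by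
  obtain ⟨ψ⟩ := hO.nonempty_deltaTheta_mulEquiv_zHat hYcl
  have key := deltaTheta_monoidHom_comp_comm ψ e.toMonoidHom
    ((MulAut.conjNormal g : MulAut ↥D.DeltaTheta).toMonoidHom)
  exact DFunLike.congr_fun key a

/-- **«F̈¹/F̈² = Ẑ·log(Ü)» from clause (a) ALONE at an origin setting**: given the census predicate
`HasThetaTopology D` (quotient topologies, `(Δ^tp_Y)^Θ` compact), the guard `IsEtThOrigin D`, `Compat`, and compactness
of `(Δ^tp_Ÿ)^Θ`, the root predicate `Prop15iiQuot E hC` follows from «log(Ü) restricts on (Δ^tp_Ÿ)^Θ to the standard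
isomorphism» (`IsStdLog λ`, `res logUdd = [λ]`). [cite: MochizukiEtTh2009, Prop 1.5 (ii) p.23] -/
theorem prop15iiQuot_of_stdLog_of_origin (hC : D.Compat) (hT : D.HasThetaTopology) (hO : D.IsEtThOrigin)
    {E : D.KummerData}
    (hcpt : IsCompact ((((D.DtpYddN 1).map D.toTheta : Subgroup D.GtpTheta)) : Set D.GtpTheta))
    {lam : ↥((D.DtpYddN 1).map D.toTheta) →ₜ* D.DeltaTheta} (hstd : IsStdLog lam)
    (hres : ContH1.res (MonoidHom.id D.GtpTheta) D.DeltaTheta D.map_toTheta_DtpYddN_one_le E.logUdd =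
      homClass dtpYddTheta_le_deltaTheta_map lam) :
    Prop15iiQuot E hC := by
  haveI := hT.t2Space_gtpTheta
  exact prop15iiQuot_of_stdLog hC hcpt (fun e g _ a => hO.endo_conjNormal_comm hT.hYcl e g a) hstd hres

end ThetaSetting

end Literature.AnabelianGeometry.EtaleTheta

end
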